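import Summits.AtomisticToContinuum.FouriersLaw.Theorems.VanishingNoiseTransferNoisyFourierAbelCorrectorExists
import Summits.AtomisticToContinuum.FouriersLaw.Theorems.VanishingNoiseTransferNoisyFourierAbelLimit
import Literature.MathematicalPhysics.KineticTheory.VelocityFlipNoise
import HarnessLib

/-!
# Kubo conductance floor from the Thomson floor (crux `VanishingNoiseTransfer.NoisyFourier`,
# stmt-AtomisticToContinuum-11977, line `abel-storage-decay`, stub P `stub_kuboConductanceFloor`)

`--supports stmt-AtomisticToContinuum-11977` file (worker of lead c6). Cheap glue recording that the floor P of
the live line (`liminf_L D_L > 0` for the finite-volume Kubo conductance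
`D_L = (L−1)·γ(1 − (γ/T²)∫ g (p_0² − T) dμ_T)` of the open velocity-flip chain, `g` a classical forward field)
is IMPLIED by lead c5's stronger, `s`-uniform Thomson floor A7 (`stub_thomsonFloor`, recorded inactive in the
work item): `c·(L−1) ≤ ∫ J_L u dμ_T` for every classical Abel corrector `u` at every `s ∈ (0,1]`, `L ≥ L₀`.

Proof: classical Abel correctors exist at every `s > 0` (landed A2 `stub_abelCorrectorExists`, p133524), and
along them `∫ J_L u_s dμ_T → (L−1)²γ(T² − γ∫ g (p_0² − T) dμ_T) = T²(L−1)·D_L` as `s → 0⁺` for EVERY forward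
field `g` (landed A3 `stub_abelLimit`, p133374); pass to the limit in A7 (`ge_of_tendsto` along `𝓝[>] 0`) and
divide by `T²(L−1) > 0`: `D_L ≥ c/T²`.

* `kuboFloor_of_thomsonFloor` — A7 ⇒ P (constant `c/T²`, same `L₀`);
* `helper_kuboFloorOfThomsonFloor` — registered notation-free restatement.

No definitions; axioms `propext`, `Classical.choice`, `Quot.sound` only. [folklore]
-/

noncomputable section

open MeasureTheory Filter Topology Finset
open scoped BigOperators

namespace Summit.AtomisticToContinuum.FouriersLaw.Theorems.NoisyFourier.KuboFloor

open Literature.MathematicalPhysics.KineticTheory.HeatConduction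
open Summit.AtomisticToContinuum.FouriersLaw.Theorems.SuperadditiveResistance.DeviceLiouville (kin)
open Summit.AtomisticToContinuum.FouriersLaw.Cruxes.NoisyFourier.AbelKapitzaEvenCorrector
  (stub_abelCorrectorExists stub_abelLimit)

/-- **Thomson floor ⇒ Kubo conductance floor (A7 ⇒ P).** If for all parameters there are `c > 0` and `L₀` with
`c·(L−1) ≤ ∫ J_L u dμ_T` for every `L ≥ L₀`, `L ≥ 2`, every `s ∈ (0,1]` and every classical Abel corrector `u`
at `s` (hypothesis `hA7`, lead c5's `stub_thomsonFloor` verbatim), then for the same `L`, every classical forward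
field `g` has `c/T² ≤ (L−1)·γ(1 − (γ/T²)∫ g (p_0² − T) dμ_T)`: let `s → 0⁺` along the landed correctors (A2) in
A7 using the landed Abel limit (A3). [folklore] -/
theorem kuboFloor_of_thomsonFloor
    (hA7 : ∀ (ω₂ lam β γ T ε : ℝ), 0 < ω₂ → 0 < lam → 0 < β → 0 < γ → 0 < T → 0 < ε →
      ∃ c : ℝ, 0 < c ∧ ∃ L₀ : ℕ, ∀ (L : ℕ), L₀ ≤ L → 2 ≤ L → ∀ s : ℝ, 0 < s → s ≤ 1 →
        ∀ u : PhaseSpace L → ℝ,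
          (ContDiff ℝ 2 u ∧ MemLp u 2 ((pinnedChain ω₂ lam β γ).gibbsMeasure L T) ∧
            ∀ x, (pinnedChain ω₂ lam β γ).flipGenerator L T T ε u x =
              s * u x - ∑ i : Fin L, (pinnedChain ω₂ lam β γ).bondCurrent L i x) →
          c * ((L : ℝ) - 1) ≤ ∫ x, (∑ i : Fin L, (pinnedChain ω₂ lam β γ).bondCurrent L i x) * u x
            ∂((pinnedChain ω₂ lam β γ).gibbsMeasure L T)) :
    ∀ (ω₂ lam β γ T ε : ℝ), 0 < ω₂ → 0 < lam → 0 < β → 0 < γ → 0 < T → 0 < ε →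
      ∃ c : ℝ, 0 < c ∧ ∃ L₀ : ℕ, ∀ (L : ℕ), L₀ ≤ L → 2 ≤ L → ∀ g : PhaseSpace L → ℝ,
        (ContDiff ℝ 2 g ∧ MemLp g 2 ((pinnedChain ω₂ lam β γ).gibbsMeasure L T) ∧
          ∀ x, (pinnedChain ω₂ lam β γ).flipGenerator L T T ε g x = -(kin L 0 x - T)) →
        c ≤ ((L : ℝ) - 1) * (γ * (1 - γ / T ^ 2 *
          ∫ x, g x * (kin L 0 x - T) ∂((pinnedChain ω₂ lam β γ).gibbsMeasure L T))) := by
  intro ω₂ lam β γ T ε hω hl hβ hγ hT hε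
  obtain ⟨c, hc, L₀, hfl⟩ := hA7 ω₂ lam β γ T ε hω hl hβ hγ hT hε
  have hT2 : 0 < T ^ 2 := by positivity
  refine ⟨c / T ^ 2, div_pos hc hT2, L₀, fun L hL₀ hL g hg => ?_⟩
  classical
  set P := pinnedChain ω₂ lam β γ with hP
  -- classical Abel correctors at every `s > 0` (A2, landed), junk off `s > 0`
  have hA2 := stub_abelCorrectorExists ω₂ lam β γ T ε hω hl hβ hγ hT hε
  set uc : ℝ → PhaseSpace L → ℝ := fun t => if h : 0 < t then (hA2 L hL t h).choose else fun _ => 0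
    with hucdef
  have huc : ∀ t : ℝ, 0 < t → ContDiff ℝ 2 (uc t) ∧ MemLp (uc t) 2 (P.gibbsMeasure L T) ∧
      ∀ x, P.flipGenerator L T T ε (uc t) x = t * uc t x - ∑ i : Fin L, P.bondCurrent L i x := by
    intro t ht
    have e : uc t = (hA2 L hL t ht).choose := by simp only [hucdef, dif_pos ht]
    rw [e]
    exact (hA2 L hL t ht).choose_spec
  -- the Abel limit along them (A3, landed)
  have hlim := stub_abelLimit ω₂ lam β γ T ε hω hl hβ hγ hT hε L hL g hg uc (fun s hs _ => huc s hs)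
  -- A7 along `s ∈ (0,1]`
  have hev : ∀ᶠ s in 𝓝[>] (0 : ℝ), c * ((L : ℝ) - 1) ≤
      ∫ x, (∑ i : Fin L, P.bondCurrent L i x) * uc s x ∂(P.gibbsMeasure L T) := by
    filter_upwards [Ioc_mem_nhdsGT (zero_lt_one' ℝ)] with s hs
    exact hfl L hL₀ hL s hs.1 hs.2 (uc s) (huc s hs.1)
  haveI : (𝓝[>] (0 : ℝ)).NeBot := nhdsGT_neBot 0
  have hge : c * ((L : ℝ) - 1) ≤ ((L : ℝ) - 1) ^ 2 *
      (γ * (T ^ 2 - γ * ∫ x, g x * (kin L 0 x - T) ∂(P.gibbsMeasure L T))) := ge_of_tendsto hlim hev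
  -- divide by `T² (L − 1)`
  have hN1 : 0 < (L : ℝ) - 1 := by
    have : (2 : ℝ) ≤ L := by exact_mod_cast hL
    linarith
  rw [div_le_iff₀ hT2]
  have e : ((L : ℝ) - 1) * (γ * (1 - γ / T ^ 2 * ∫ x, g x * (kin L 0 x - T) ∂(P.gibbsMeasure L T))) * T ^ 2 =
      ((L : ℝ) - 1) ^ 2 * (γ * (T ^ 2 - γ * ∫ x, g x * (kin L 0 x - T) ∂(P.gibbsMeasure L T))) /
        ((L : ℝ) - 1) := by
    field_simp
  rw [e, le_div_iff₀ hN1]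
  exact hge

/-! ## Registered helper (notation-free restatement) -/

/-- Registered helper sub-goal `helper_kuboFloorOfThomsonFloor` of crux stmt-AtomisticToContinuum-11977 (line
`abel-storage-decay`, stub P `stub_kuboConductanceFloor`): lead c5's Thomson floor A7 (`stub_thomsonFloor`, text
verbatim as hypothesis) implies the registered stub P verbatim (`kuboFloor_of_thomsonFloor`, restated). [folklore] -/
theorem helper_kuboFloorOfThomsonFloor : (∀ (ω₂ lam β γ T ε : ℝ), 0 < ω₂ → 0 < lam → 0 < β → 0 < γ → 0 < T → 0 < ε → ∃ c : ℝ, 0 < c ∧ ∃ L₀ : ℕ, ∀ (L : ℕ), L₀ ≤ L → 2 ≤ L → ∀ s : ℝ, 0 < s → s ≤ 1 → ∀ u : Literature.MathematicalPhysics.KineticTheory.HeatConduction.PhaseSpace L → ℝ, (ContDiff ℝ 2 u ∧ MeasureTheory.MemLp u 2 ((Literature.MathematicalPhysics.KineticTheory.HeatConduction.pinnedChain ω₂ lam β γ).gibbsMeasure L T) ∧ ∀ x, (Literature.MathematicalPhysics.KineticTheory.HeatConduction.pinnedChain ω₂ lam β γ).flipGenerator L T T ε u x = s * u x - ∑ i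 : Fin L, (Literature.MathematicalPhysics.KineticTheory.HeatConduction.pinnedChain ω₂ lam β γ).bondCurrent L i x) → c * ((L : ℝ) - 1) ≤ MeasureTheory.integral ((Literature.MathematicalPhysics.KineticTheory.HeatConduction.pinnedChain ω₂ lam β γ).gibbsMeasure L T) (fun x => (∑ i : Fin L, (Literature.MathematicalPhysics.KineticTheory.HeatConduction.pinnedChain ω₂ lam β γ).bondCurrent L i x) * u x)) → (∀ (ω₂ lam β γ T ε : ℝ), 0 < ω₂ → 0 < lam → 0 < β → 0 < γ → 0 < T → 0 < ε → ∃ c : ℝ, 0 < c ∧ ∃ L₀ : ℕ, ∀ (L : ℕ), L₀ ≤ L → 2 ≤ L → ∀ g : Literature.MathematicalPhysics.KineticTheory.HeatConduction.PhaseSpace L → ℝ, (ContDiff ℝ 2 g ∧ MeasureTheory.MemLp g 2 ((Literature.MathematicalPhysics.KineticTheory.HeatConduction.pinnedChain ω₂ lam β γ).gibbsMeasure L T) ∧ ∀ x, (Literature.MathematicalPhysics.KineticTheory.HeatConduction.pinnedChain ω₂ lam β γ).flipGenerator L T T ε g x = -(Summit.AtomisticToContinuum.FouriersLaw.Theorems.SuperadditiveResistance.DeviceLiouville.kin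 L 0 x - T)) → c ≤ ((L : ℝ) - 1) * (γ * (1 - γ / T ^ 2 * MeasureTheory.integral ((Literature.MathematicalPhysics.KineticTheory.HeatConduction.pinnedChain ω₂ lam β γ).gibbsMeasure L T) (fun x => g x * (Summit.AtomisticToContinuum.FouriersLaw.Theorems.SuperadditiveResistance.DeviceLiouville.kin L 0 x - T))))) :=
  fun hA7 => kuboFloor_of_thomsonFloor hA7

end Summit.AtomisticToContinuum.FouriersLaw.Theorems.NoisyFourier.KuboFloor

end
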